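import Literature.Probability.Percolation.ArmSeparationExtSlotSep
import Literature.Probability.Percolation.ArmSeparationExtSlotPairs
import HarnessLib

/-!
# Outer slots: the supports of the two colours are disjoint

Topic: Probability / Percolation; family `crit-perc`. A brick of the discharge of
`Literature.Probability.Percolation.Nolin2008_twoArm_separation` (Nolin 2008, Thm. 11
[arXiv 0711.4948: Thm. 10]; `ArmSeparation.lean`), landing of the EXTERNAL extremities (mirror of
`ArmSeparationSlotDisjoint.lean`): for a valid rung and a slot in range, admissible and
separated, the private support `Pfin` of the open arm (its framed slot box and spoke, its ring
arc, its four landing strips) is disjoint from the private support `Mfin` of the closed arm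
(`ESlot.disjoint_Pfin_Mfin`, twenty pairs of pieces: the near sets by `enearSet_disjoint_…` /
`rotNear_disjoint_rotNear`, arc versus near by `ringTube_disjoint_rotSpoke`, the approach strip
versus near by `longSector_disjoint_rotNear` or the danger zone, the approach strip versus the
white arc by `neg_ringTube_disjoint_strip`, everything else by norms or the sign of `x₀`), and
both are disjoint from the shared support `Λ_{2M}` (`ESlot.disjoint_sharedE`).

## References

* P. Nolin, *Near-critical percolation in two dimensions*, Electron. J. Probab. 13 (2008), §4.3
  Lemma 13 (disjoint supports), §4.4 [arXiv 0711.4948: Lemma 12, Thm. 10]. [Nolin2008]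
-/

noncomputable section

open Set

namespace Literature.Probability.Percolation

open LatticeModels Tube

/-- `-ρ^{(i+3) % 6} u = ρ^i u`. [folklore] -/
theorem neg_rot_ic' (i : ℕ) (u : Site 2) : -triRotIsoPow ((i + 3) % 6) u = triRotIsoPow i u := by
  rw [← triRotIsoPow_three_apply, ← triRotIsoPow_add_apply, ← triRotIsoPow_mod_six_apply ((i + 3) % 6 + 3),
    show ((i + 3) % 6 + 3) % 6 = i % 6 by omega, triRotIsoPow_mod_six_apply]

namespace ESlot

variable {P : EParams} {σ : ESlot}

/-! ### The pieces of the two supports -/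

/-- Membership in `Pfin`, sorted into near set, arc, approach strip and far strips. [folklore] -/
theorem mem_Pfin_cases {v : Site 2} (hv : v ∈ σ.Pfin P) :
    v ∈ enearSet σ.io P.M (σ.ko P) (σ.To P) P.w (σ.wo P) (P.LB - σ.ko P) P.ε ∨
      v ∈ boxAll (arc (thinRing P.rB P.e P.s) (σ.aB P) P.lenB) ∨
      v ∈ triStrip ((P.rB : ℤ) - P.e - 1) (σ.tgo P) P.WB (P.rB / 64) ∨
      (P.N : ℤ) - (P.N / 8 : ℕ) ≤ v 0 := by
  rw [Pfin, Finset.mem_union, Finset.mem_image] at hv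
  rcases hv with ⟨u, hu, rfl⟩ | hv
  · exact Or.inl ⟨u, Or.inl hu, rfl⟩
  · unfold ecorrFin at hv
    simp only [Finset.mem_union, Finset.mem_image] at hv
    rcases hv with ((((⟨u, hu, rfl⟩ | hv) | hv) | hv) | hv) | hv
    · refine Or.inl ⟨u, Or.inr ?_, rfl⟩; rw [← coe_sites]; exact hu
    · right; left; rw [← coe_sitesAll]; exact hv
    · right; right; left; rw [← coe_triStripFinset]; exact hv
    · right; right; right
      rw [← Finset.mem_coe, coe_triStripFinset, mem_triStrip] at hv; exact hv.1
    · right; right; right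
      rw [← Finset.mem_coe, coe_triStripFinset, mem_triStrip] at hv; exact hv.1
    · right; right; right
      rw [← Finset.mem_coe, coe_triStripFinset, mem_triStrip] at hv; omega

/-- Membership in `Mfin`: the white near set, or `-v` in the white arc, approach strip or far strips. [folklore] -/
theorem mem_Mfin_cases {v : Site 2} (hv : v ∈ σ.Mfin P) :
    v ∈ enearSet σ.ic P.M (σ.kc P) (σ.Tc P) P.w (σ.wc P) (P.LW - σ.kc P) P.ε ∨
      -v ∈ boxAll (arc (thinRing P.rW P.e P.s) (σ.aW P) (σ.lenW P)) ∨
      -v ∈ triStrip ((P.rW : ℤ) - P.e - 1) (σ.tgc P) P.WW (P.rW / 64) ∨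
      (P.N : ℤ) - (P.N / 8 : ℕ) ≤ (-v) 0 := by
  rw [Mfin, Finset.mem_union, Finset.mem_image, Finset.mem_image] at hv
  rcases hv with ⟨u, hu, rfl⟩ | ⟨x, hx, hxv⟩
  · exact Or.inl ⟨u, Or.inl hu, rfl⟩
  · have hx' : x = -v := by rw [← hxv, neg_neg]
    subst hx'
    unfold ecorrFin at hx
    simp only [Finset.mem_union, Finset.mem_image] at hx
    rcases hx with ((((⟨u, hu, huv⟩ | hx) | hx) | hx) | hx) | hx
    · left
      refine ⟨u, Or.inr ?_, ?_⟩
      · rw [← coe_sites]; exact hu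
      · have : triRotIsoPow σ.ic u = -triRotIsoPow σ.ic' u := (neg_rot_ic' σ.ic u).symm
        rw [this, huv, neg_neg]
    · right; left; rw [← coe_sitesAll]; exact hx
    · right; right; left; rw [← coe_triStripFinset]; exact hx
    · right; right; right
      rw [← Finset.mem_coe, coe_triStripFinset, mem_triStrip] at hx; exact hx.1
    · right; right; right
      rw [← Finset.mem_coe, coe_triStripFinset, mem_triStrip] at hx; exact hx.1
    · right; right; right
      rw [← Finset.mem_coe, coe_triStripFinset, mem_triStrip] at hx; omega

/-! ### The private supports of the two colours are disjoint -/

/-- **The private supports of the two colours are disjoint** for a valid rung and a slot in range,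
admissible and separated. [cite: Nolin2008, §4.3 Lemma 13 (arXiv 0711.4948: Lemma 12, disjoint supports `𝒜⁺`, `𝒜⁻`)] -/
theorem disjoint_Pfin_Mfin (hV : P.Valid) (hσ : σ.InRange P) (hadm : σ.AdmissibleE P) (hsep : σ.SepOKE P) :
    Disjoint (σ.Pfin P) (σ.Mfin P) := by
  obtain ⟨⟨hs, hk₀, hμ, hw1, hw2, he1, he2, hε1, hε2⟩, ⟨hrB1, hrB2, hrW1, hrW2, hnB, hnW⟩, ⟨hLB, hLW, hWB, hWW⟩,
    ⟨hM, hR₀, hR₀M, hn, hN, hN'⟩, ⟨hko1, hko2, hkc1, hkc2, hwo1, hwo2, hwc1, hwc2, hξo, hξc⟩,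
    ⟨ha1, ha2, ha3, ha4, ht1, ht2, ht3, ht4⟩, ⟨ho1, ho2, hc1, hc2, hw1', hw2'⟩⟩ := eifacts hV hσ hadm
  have hs0 : 0 < P.s := by clear * - hs hk₀; omega
  have hko4 : ((σ.ko P / 4 : ℕ) : ℤ) ≤ σ.ko P := by exact_mod_cast Nat.div_le_self _ _
  have hkc4 : ((σ.kc P / 4 : ℕ) : ℤ) ≤ σ.kc P := by exact_mod_cast Nat.div_le_self _ _
  have hko4' : 4 * ((σ.ko P / 4 : ℕ) : ℤ) ≤ σ.ko P := by exact_mod_cast Nat.mul_div_le _ _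
  have hkc4' : 4 * ((σ.kc P / 4 : ℕ) : ℤ) ≤ σ.kc P := by exact_mod_cast Nat.mul_div_le _ _
  have h0ko4 : (0 : ℤ) ≤ (σ.ko P / 4 : ℕ) := Nat.cast_nonneg _
  have h0kc4 : (0 : ℤ) ≤ (σ.kc P / 4 : ℕ) := Nat.cast_nonneg _
  have hrB4 : 4 * ((P.rB / 4 : ℕ) : ℤ) ≤ P.rB ∧ (P.rB : ℤ) ≤ 4 * ((P.rB / 4 : ℕ) : ℤ) + 3 := by clear * - hs0; omega
  have hrB64 : 64 * ((P.rB / 64 : ℕ) : ℤ) ≤ P.rB ∧ (P.rB : ℤ) ≤ 64 * ((P.rB / 64 : ℕ) : ℤ) + 63 := by clear * - hs0; omega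
  have hrB8 : 8 * ((P.rB / 8 : ℕ) : ℤ) ≤ P.rB ∧ (P.rB : ℤ) ≤ 8 * ((P.rB / 8 : ℕ) : ℤ) + 7 := by clear * - hs0; omega
  have hN8 : 8 * ((P.N / 8 : ℕ) : ℤ) ≤ P.N ∧ (P.N : ℤ) ≤ 8 * ((P.N / 8 : ℕ) : ℤ) + 7 := by clear * - hs0; omega
  -- side conditions of the near sets (ℕ)
  have nw : 1 ≤ P.w := by clear * - hw1 hw2 hk₀; omega
  have nLo : σ.ko P + 1 ≤ P.LB - σ.ko P := by clear * - hLB hrB1 hko2 hμ hs hk₀; omega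
  have nLc : σ.kc P + 1 ≤ P.LW - σ.kc P := by clear * - hLW hrW1 hkc2 hμ hs hk₀; omega
  have nfo : (σ.wo P : ℤ) + (σ.ko P / 4 : ℕ) + 2 * P.ε ≤ σ.ko P := by
    have : ((σ.ko P / 4 : ℕ) : ℤ) * 4 ≤ σ.ko P := by linarith
    clear * - this hwo2 hw1 hε1 hko1 hk₀; omega
  have nfc : (σ.wc P : ℤ) + (σ.kc P / 4 : ℕ) + 2 * P.ε ≤ σ.kc P := by
    have : ((σ.kc P / 4 : ℕ) : ℤ) * 4 ≤ σ.kc P := by linarith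
    clear * - this hwc2 hw1 hε1 hkc1 hk₀; omega
  have nwwo : P.w ≤ σ.wo P := by exact_mod_cast hwo1
  have nwwc : P.w ≤ σ.wc P := by exact_mod_cast hwc1
  have nToL : -(2 * (P.M : ℤ)) ≤ σ.To P := by clear * - ha2 hR₀ hw1 hμ hk₀; omega
  have nTcL : -(2 * (P.M : ℤ)) ≤ σ.Tc P := by clear * - ha4 hR₀ hw1 hμ hk₀; omega
  have nToH : σ.To P + P.w + 2 * σ.ko P ≤ 0 := by clear * - ha1 hR₀ hw1 hko2 hμ hk₀; omega
  have nTcH : σ.Tc P + P.w + 2 * σ.kc P ≤ 0 := by clear * - ha3 hR₀ hw1 hkc2 hμ hk₀; omega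
  -- norms
  have hLBo : ((P.LB - σ.ko P : ℕ) : ℤ) = P.LB - σ.ko P := by clear * - nLo; omega
  have hLWc : ((P.LW - σ.kc P : ℕ) : ℤ) = P.LW - σ.kc P := by clear * - nLc; omega
  have normB : ∀ v ∈ enearSet σ.io P.M (σ.ko P) (σ.To P) P.w (σ.wo P) (P.LB - σ.ko P) P.ε,
      2 * (P.M : ℤ) + 1 ≤ triNorm v ∧ triNorm v ≤ (P.rB : ℤ) + P.e + P.s := fun v hv => by
    have h := norm_of_mem_enearSet hσ.hio nw nLo nwwo nfo nToL nToH hv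
    rw [hLBo] at h; clear * - h hLB; constructor <;> linarith [h.1, h.2]
  have normW : ∀ v ∈ enearSet σ.ic P.M (σ.kc P) (σ.Tc P) P.w (σ.wc P) (P.LW - σ.kc P) P.ε,
      2 * (P.M : ℤ) + 1 ≤ triNorm v ∧ triNorm v ≤ (P.rW : ℤ) + P.e + P.s := fun v hv => by
    have h := norm_of_mem_enearSet hσ.hic nw nLc nwwc nfc nTcL nTcH hv
    rw [hLWc] at h; clear * - h hLW; constructor <;> linarith [h.1, h.2]
  have he2r : 2 * P.e ≤ P.rB := by clear * - he1 hrB1 hμ hk₀; omega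
  have he2r' : 2 * P.e ≤ P.rW := by clear * - he1 hrW1 hμ hk₀; omega
  have normArcB : ∀ v ∈ boxAll (arc (thinRing P.rB P.e P.s) (σ.aB P) P.lenB),
      (P.rB : ℤ) - P.s - 2 * P.e ≤ triNorm v ∧ triNorm v ≤ (P.rB : ℤ) + 2 * P.e := by
    rintro v ⟨T, hT, hvT⟩; exact triNorm_mem_of_mem_thinRing he2r (mem_of_mem_arc hT) hvT
  have normArcW : ∀ v ∈ boxAll (arc (thinRing P.rW P.e P.s) (σ.aW P) (σ.lenW P)),
      (P.rW : ℤ) - P.s - 2 * P.e ≤ triNorm v ∧ triNorm v ≤ (P.rW : ℤ) + 2 * P.e := by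
    rintro v ⟨T, hT, hvT⟩; exact triNorm_mem_of_mem_thinRing he2r' (mem_of_mem_arc hT) hvT
  -- the twenty pairs
  rw [Finset.disjoint_left]
  intro v hvP hvM
  rcases mem_Pfin_cases hvP with hP | hP | hP | hP <;> rcases mem_Mfin_cases hvM with hQ | hQ | hQ | hQ
  · -- near / near
    by_cases hii : σ.io = σ.ic
    · rw [hii] at hP
      rcases hsep with h | h | h
      · exact h hii
      · have hrow : σ.To P + P.w + 2 * σ.ko P < σ.Tc P + 1 := by linarith only [h, hw1, hko1, hk₀]
        exact Set.disjoint_left.1 (enearSet_disjoint_enearSet_same (i := σ.ic) (M := P.M) (k := σ.ko P) (k' := σ.kc P)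
          (T₀ := σ.To P) (T₀' := σ.Tc P) (w := P.w) (w₁ := σ.wo P) (w₂ := σ.wc P) (L := P.LB - σ.ko P) (L' := P.LW - σ.kc P)
          (ε := P.ε) nw nLo nLc nwwo nwwc nfo nfc hrow) hP hQ
      · have hrow : σ.Tc P + P.w + 2 * σ.kc P < σ.To P + 1 := by linarith only [h, hw1, hkc1, hk₀]
        exact Set.disjoint_left.1 (enearSet_disjoint_enearSet_same (i := σ.ic) (M := P.M) (k := σ.kc P) (k' := σ.ko P)
          (T₀ := σ.Tc P) (T₀' := σ.To P) (w := P.w) (w₁ := σ.wc P) (w₂ := σ.wo P) (L := P.LW - σ.kc P) (L' := P.LB - σ.ko P)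
          (ε := P.ε) nw nLc nLo nwwc nwwo nfc nfo hrow) hQ hP
    · have lam3 : ((3 * P.μ + 3 * P.s : ℕ) : ℤ) = 3 * P.μ + 3 * P.s := by push_cast; ring
      have h2μ : 2 * P.μ ≤ P.R₀ := by clear * - hR₀; omega
      have hm₀ : ((P.R₀ - 2 * P.μ : ℕ) : ℤ) = P.R₀ - 2 * P.μ := by clear * - h2μ; omega
      have gB1 : (σ.ko P : ℤ) + ((P.LB - σ.ko P : ℕ) : ℤ) ≤ ((3 * P.μ + 3 * P.s : ℕ) : ℤ) := by
        rw [hLBo, lam3]; linarith only [hLB, hrB2, hμ, hs, hk₀, he1]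
      have gW1 : (σ.kc P : ℤ) + ((P.LW - σ.kc P : ℕ) : ℤ) ≤ ((3 * P.μ + 3 * P.s : ℕ) : ℤ) := by
        rw [hLWc, lam3]; linarith only [hLW, hrW2, hμ, hs, hk₀, he1]
      have gB2 : -(2 * (P.M : ℤ)) + ((P.R₀ - 2 * P.μ : ℕ) : ℤ) ≤ σ.To P + 1 := by rw [hm₀]; linarith only [ha2, hw1, hμ, hk₀]
      have gW2 : -(2 * (P.M : ℤ)) + ((P.R₀ - 2 * P.μ : ℕ) : ℤ) ≤ σ.Tc P + 1 := by rw [hm₀]; linarith only [ha4, hw1, hμ, hk₀]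
      have gB3 : σ.To P + P.w + 2 * σ.ko P ≤ -(((P.R₀ - 2 * P.μ : ℕ) : ℤ)) := by rw [hm₀]; linarith only [ha1, hko2, hw1, hμ, hk₀]
      have gW3 : σ.Tc P + P.w + 2 * σ.kc P ≤ -(((P.R₀ - 2 * P.μ : ℕ) : ℤ)) := by rw [hm₀]; linarith only [ha3, hkc2, hw1, hμ, hk₀]
      have glm : 3 * P.μ + 3 * P.s < P.R₀ - 2 * P.μ := by clear * - hR₀ hμ hs hk₀; omega
      have sB := enearSet_subset_rotNear (i := σ.io) (M := P.M) (k := σ.ko P) (T₀ := σ.To P) (w := P.w) (w' := σ.wo P)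
        (L := P.LB - σ.ko P) (ε := P.ε) (lam := 3 * P.μ + 3 * P.s) (m₀ := P.R₀ - 2 * P.μ) nw nLo nwwo nfo gB1 gB2 gB3
      have sW := enearSet_subset_rotNear (i := σ.ic) (M := P.M) (k := σ.kc P) (T₀ := σ.Tc P) (w := P.w) (w' := σ.wc P)
        (L := P.LW - σ.kc P) (ε := P.ε) (lam := 3 * P.μ + 3 * P.s) (m₀ := P.R₀ - 2 * P.μ) nw nLc nwwc nfc gW1 gW2 gW3
      exact Set.disjoint_left.1 (rotNear_disjoint_rotNear hσ.hio hσ.hic hii glm) (sB hP) (sW hQ)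
  · have h1 := (normB v hP).2; have h2 := (normArcW (-v) hQ).1; rw [triNorm_neg] at h2
    clear * - h1 h2 hrB2 hrW1 hμ hs he1 hk₀; omega
  · have h1 := (normB v hP).2; have h2 := (le_norm_of_mem_triStrip hQ); rw [triNorm_neg] at h2
    clear * - h1 h2 hrB2 hrW1 hμ hs he1 hk₀; omega
  · have h1 := (normB v hP).2
    have h2 : (-v) 0 ≤ triNorm v := by rw [← triNorm_neg]; exact le_triNorm_iff_lin.2 (Or.inl le_rfl)
    clear * - h1 h2 hQ hrB2 hN hN8 hμ hs he1 hk₀ hM; omega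
  · -- arc B / near W
    obtain ⟨T, hT, hvT⟩ := hP
    obtain ⟨hι2, hι4, hnB1, -, hhi, -, hhi''⟩ := windowB_factsE hV hσ hadm
    have hlen : (thinRing P.rB P.e P.s).length = 12 * P.nB - 4 := by rw [length_thinRing hnB1]; rfl
    obtain ⟨g, hg, hgout, hgT⟩ := mem_arc_compl (L := thinRing P.rB P.e P.s) (lo := σ.loB P) (hi := σ.hiB P)
      (by rw [hhi]; exact Nat.le_add_right _ _) (by rw [hlen]; exact hhi'') (by
        have hl : P.lenB = (thinRing P.rB P.e P.s).length - (σ.hiB P - σ.loB P + 1) := by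
          rw [hlen, hhi]; unfold EParams.lenB; clear * - hnB1; omega
        rw [← hl]; exact hT)
    rw [hlen] at hg
    rw [getElem?_thinRing hnB1 hg, Option.some.injEq] at hgT
    subst hgT
    obtain ⟨u, hu, rfl⟩ := hQ
    rcases hu with hu | hu
    · -- white frame box: norm
      have h1 := (triNorm_mem_of_mem_thinRing he2r (List.mem_of_getElem? (getElem?_thinRing hnB1 hg)) hvT).1
      rw [Finset.mem_coe, mem_eslotFrame nw] at hu
      rw [norm_rot_eq σ.ic (M := P.M) hu.1 (by clear * - hu nTcL; omega) (by clear * - hu nTcH; omega)] at h1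
      clear * - h1 hu hrB1 hkc2 hμ hs he1 hk₀; omega
    · exact ringTube_disjoint_rotSpoke (ic := σ.ic) (ιc := σ.ιc P) (lamS := (P.R₀ : ℤ) - P.μ) hnB1 hnB he2r hg hσ.hic hι2
        (by clear * - hι4; omega) (by unfold ESlot.hiB ESlot.loB at hgout; exact hgout)
        (by rw [hξc] at hc1; exact hc1) (by rw [hξc] at hc2; exact hc2) (by clear * - he1 he2 hs hk₀; omega)
        (by clear * - hR₀ hμ he1 hk₀; omega)
        (fun x hx => by
          rw [Tube.mem_box] at hx; simp only [extSpokeTube, Nat.cast_mul, Nat.cast_ofNat] at hx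
          refine ⟨?_, ?_⟩ <;> linarith only [hx.1, hx.2.2.1, hx.2.2.2, ha3, ha4, hkc2, hkc1, hkc4', h0kc4, hwc1, hwc2, hw1, hε1, hμ, hk₀, hR₀, hs])
        (fun x hx => by
          rw [Tube.mem_box] at hx; simp only [extSpokeTube, Nat.cast_mul, Nat.cast_ofNat] at hx
          refine ⟨?_, ?_, ?_⟩ <;> linarith only [hx.1, hx.2.2.1, hx.2.2.2, nTcL, nTcH, hkc1, hkc4', h0kc4, hwc1, hwc2, hw1, hε1, hk₀])
        hvT ⟨u, hu, rfl⟩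
  · have h1 := (normArcB v hP).2; have h2 := (normArcW (-v) hQ).1; rw [triNorm_neg] at h2
    clear * - h1 h2 hrB2 hrW1 hμ hs he1 hk₀; omega
  · have h1 := (normArcB v hP).2; have h2 := (le_norm_of_mem_triStrip hQ); rw [triNorm_neg] at h2
    clear * - h1 h2 hrB2 hrW1 hμ hs he1 hk₀; omega
  · have h1 := (normArcB v hP).2
    have h2 : (-v) 0 ≤ triNorm v := by rw [← triNorm_neg]; exact le_triNorm_iff_lin.2 (Or.inl le_rfl)
    clear * - h1 h2 hQ hrB2 hN hN8 hμ hs he1 hk₀ hM; omega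
  · -- approach strip B / near W
    have hstrip := mem_triStrip.1 hP
    by_cases hic0 : σ.ic = 0
    · -- the danger zone
      obtain ⟨u, rfl, -, -, hu3, hu4⟩ := exists_of_mem_enearSet nw nLc nwwc nfc hQ
      rw [hic0] at hstrip
      obtain ⟨f0, f1, -⟩ := rot_apply_formula u
      rw [f0, f1] at hstrip  -- `v = ρ⁰ u = u`
      have hgap := tgtRow_false_add_le (n := P.rB) (by clear * - hrB1 hμ hk₀; omega)
      have hDdef : σ.bo P = !decide (σ.ic = 0 ∧ P.Danger P.rB (σ.ξc P)) := rfl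
      have htgdef : σ.tgo P = tgtRow P.rB (σ.bo P) := rfl
      have hrB16 : 16 * ((P.rB / 16 : ℕ) : ℤ) ≤ P.rB ∧ (P.rB : ℤ) ≤ 16 * ((P.rB / 16 : ℕ) : ℤ) + 15 := by clear * - hs0; omega
      by_cases hD : P.Danger P.rB (σ.ξc P)
      · have hbo : σ.bo P = false := by rw [hDdef, hic0]; simp [hD]
        rw [hbo] at htgdef
        unfold EParams.Danger at hD
        simp only [tgtRow, cond_false, cond_true] at htgdef hD hgap
        linarith only [hstrip.2.2.2, hu3, hD.1, hξc, htgdef, hwc2, hkc2, hkc4, h0kc4, hw1, hε1, hμ, hk₀, hs, hrB1, hM,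
          hrB4.1, hrB4.2, hrB16.1, hrB16.2, hrB64.1, hrB64.2]
      · have hbo : σ.bo P = true := by rw [hDdef]; simp [hD]
        rw [hbo] at htgdef
        unfold EParams.Danger at hD
        simp only [tgtRow, cond_true] at htgdef hD
        have h064 : (0 : ℤ) ≤ (P.rB / 64 : ℕ) := Nat.cast_nonneg _
        rcases not_and_or.1 hD with hD | hD <;> rw [not_le] at hD
        · linarith only [hstrip.2.2.1, hu4, hD, hξc, htgdef, hwc1, h0kc4, hkc4', hkc2, hkc1, hw1, hε1, hμ, hk₀, hs, h064]
        · linarith only [hstrip.2.2.2, hu3, hD, hξc, htgdef, hwc2, hkc2, hkc4, h0kc4, hkc1, hw1, hε1, hμ, hk₀, hs, h064]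
    · have h2μ : 2 * P.μ ≤ P.R₀ := by clear * - hR₀; omega
      have hm₀ : ((P.R₀ - 2 * P.μ : ℕ) : ℤ) = P.R₀ - 2 * P.μ := by clear * - h2μ; omega
      have lam3 : ((3 * P.μ + 3 * P.s : ℕ) : ℤ) = 3 * P.μ + 3 * P.s := by push_cast; ring
      have gW1 : (σ.kc P : ℤ) + ((P.LW - σ.kc P : ℕ) : ℤ) ≤ ((3 * P.μ + 3 * P.s : ℕ) : ℤ) := by
        rw [hLWc, lam3]; linarith only [hLW, hrW2, hμ, hs, hk₀, he1]
      have gW2 : -(2 * (P.M : ℤ)) + ((P.R₀ - 2 * P.μ : ℕ) : ℤ) ≤ σ.Tc P + 1 := by rw [hm₀]; linarith only [ha4, hw1, hμ, hk₀]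
      have gW3 : σ.Tc P + P.w + 2 * σ.kc P ≤ -(((P.R₀ - 2 * P.μ : ℕ) : ℤ)) := by rw [hm₀]; linarith only [ha3, hkc2, hw1, hμ, hk₀]
      have glm : 3 * P.μ + 3 * P.s < P.R₀ - 2 * P.μ := by clear * - hR₀ hμ hs hk₀; omega
      have sW := enearSet_subset_rotNear (i := σ.ic) (M := P.M) (k := σ.kc P) (T₀ := σ.Tc P) (w := P.w) (w' := σ.wc P)
        (L := P.LW - σ.kc P) (ε := P.ε) (lam := 3 * P.μ + 3 * P.s) (m₀ := P.R₀ - 2 * P.μ) nw nLc nwwc nfc gW1 gW2 gW3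
      have hvL : v ∈ longSector P.M (P.R₀ - 2 * P.μ) := by
        refine ⟨?_, ?_, ?_⟩
        · linarith only [hstrip.1, hrB1, he1, hμ, hk₀]
        · rw [hm₀]; linarith only [hstrip.2.2.1, ht1, hrB2, hrB4.2, hrB1, hR₀M, hμ, hs, hk₀, hM]
        · rw [hm₀]; linarith only [hstrip.2.2.2, ht2, hrB4.2, hrB64.1, hrB1, hR₀M, hM, hμ, hk₀]
      exact Set.disjoint_left.1 (longSector_disjoint_rotNear hic0 hσ.hic glm) hvL (sW hQ)
  · -- approach strip B / arc W: the window of ring W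
    obtain ⟨T, hT, hvT⟩ := hQ
    obtain ⟨hnW1, hlohi, hhi, -, -, -, -, -, -⟩ := windowW_factsE hV hσ hadm
    have hlen : (thinRing P.rW P.e P.s).length = 12 * P.nW - 4 := by rw [length_thinRing hnW1]; rfl
    obtain ⟨g, hg, hgout, hgT⟩ := mem_arc_compl (L := thinRing P.rW P.e P.s) (lo := σ.loW P) (hi := σ.hiW P)
      hlohi (by rw [hlen]; exact hhi) (by rw [hlen]; exact hT)
    rw [hlen] at hg
    rw [getElem?_thinRing hnW1 hg, Option.some.injEq] at hgT
    subst hgT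
    exact neg_ringTube_disjoint_strip (lam₀ := (P.rB / 8 : ℕ)) hnW1 hnW he2r' hg (by clear * - he1 he2 hs hk₀; omega)
      (by clear * - ht1 hrB2 hrW1 hμ hs; omega)
      (by unfold ESlot.hiW ESlot.loW ESlot.yLo ESlot.yHi at hgout; exact hgout)
      (by clear * - he1 hrB1 hrB8 hμ hk₀ hM; omega)
      (fun x hx => by rw [mem_triStrip] at hx; clear * - hx ht1 ht2 hrB4 hrB8 hrB64 he1 hrB1 hμ hk₀ hM; constructor <;> omega)
      hvT hP
  · have h1 := (le_norm_of_mem_triStrip hP).1; have h2 := (le_norm_of_mem_triStrip hQ).1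
    simp only [Pi.neg_apply] at h2
    clear * - h1 h2 hrB1 hrW1 he1 hμ hk₀; omega
  · have h1 := (le_norm_of_mem_triStrip hP).1; simp only [Pi.neg_apply] at hQ
    clear * - h1 hQ hrB1 hN hN8 he1 hμ hk₀ hM; omega
  · -- far strips B / near W: norms
    have h2 := (normW v hQ).2
    have h1 : v 0 ≤ triNorm v := le_triNorm_iff_lin.2 (Or.inl le_rfl)
    clear * - h1 h2 hP hrW2 hN hN8 hμ hs he1 hk₀ hM; omega
  · have h2 := (normArcW (-v) hQ).2; rw [triNorm_neg] at h2
    have h1 : v 0 ≤ triNorm v := le_triNorm_iff_lin.2 (Or.inl le_rfl)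
    clear * - h1 h2 hP hrW2 hN hN8 hμ hs he1 hk₀ hM; omega
  · have h2 := (le_norm_of_mem_triStrip hQ).1; simp only [Pi.neg_apply] at h2
    clear * - hP h2 hrW1 hN hN8 he1 hμ hk₀ hM; omega
  · simp only [Pi.neg_apply] at hQ
    clear * - hP hQ hN hN8 hM hμ hk₀; omega

/-- **The shared support `Λ_{2M}` is disjoint from the private supports** (all private sites have
norm `> 2M`). [cite: Nolin2008, §4.3 Lemma 13 (arXiv 0711.4948: Lemma 12)] -/
theorem disjoint_sharedE (hV : P.Valid) (hσ : σ.InRange P) (hadm : σ.AdmissibleE P) :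
    Disjoint (triBall (2 * P.M)) (σ.Pfin P) ∧ Disjoint (triBall (2 * P.M)) (σ.Mfin P) := by
  obtain ⟨⟨hs, hk₀, hμ, hw1, hw2, he1, he2, hε1, hε2⟩, ⟨hrB1, hrB2, hrW1, hrW2, hnB, hnW⟩, ⟨hLB, hLW, hWB, hWW⟩,
    ⟨hM, hR₀, hR₀M, hn, hN, hN'⟩, ⟨hko1, hko2, hkc1, hkc2, hwo1, hwo2, hwc1, hwc2, hξo, hξc⟩,
    ⟨ha1, ha2, ha3, ha4, -, -, -, -⟩, -⟩ := eifacts hV hσ hadm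
  have hs0 : 0 < P.s := by clear * - hs hk₀; omega
  have hN8 : 8 * ((P.N / 8 : ℕ) : ℤ) ≤ P.N ∧ (P.N : ℤ) ≤ 8 * ((P.N / 8 : ℕ) : ℤ) + 7 := by clear * - hs0; omega
  have hko4' : 4 * ((σ.ko P / 4 : ℕ) : ℤ) ≤ σ.ko P := by exact_mod_cast Nat.mul_div_le _ _
  have hkc4' : 4 * ((σ.kc P / 4 : ℕ) : ℤ) ≤ σ.kc P := by exact_mod_cast Nat.mul_div_le _ _
  have nw : 1 ≤ P.w := by clear * - hw1 hw2 hk₀; omega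
  have nLo : σ.ko P + 1 ≤ P.LB - σ.ko P := by clear * - hLB hrB1 hko2 hμ hs hk₀; omega
  have nLc : σ.kc P + 1 ≤ P.LW - σ.kc P := by clear * - hLW hrW1 hkc2 hμ hs hk₀; omega
  have nfo : (σ.wo P : ℤ) + (σ.ko P / 4 : ℕ) + 2 * P.ε ≤ σ.ko P := by
    have : ((σ.ko P / 4 : ℕ) : ℤ) * 4 ≤ σ.ko P := by linarith
    clear * - this hwo2 hw1 hε1 hko1 hk₀; omega
  have nfc : (σ.wc P : ℤ) + (σ.kc P / 4 : ℕ) + 2 * P.ε ≤ σ.kc P := by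
    have : ((σ.kc P / 4 : ℕ) : ℤ) * 4 ≤ σ.kc P := by linarith
    clear * - this hwc2 hw1 hε1 hkc1 hk₀; omega
  have nwwo : P.w ≤ σ.wo P := by exact_mod_cast hwo1
  have nwwc : P.w ≤ σ.wc P := by exact_mod_cast hwc1
  have nToL : -(2 * (P.M : ℤ)) ≤ σ.To P := by clear * - ha2 hR₀ hw1 hμ hk₀; omega
  have nTcL : -(2 * (P.M : ℤ)) ≤ σ.Tc P := by clear * - ha4 hR₀ hw1 hμ hk₀; omega
  have nToH : σ.To P + P.w + 2 * σ.ko P ≤ 0 := by clear * - ha1 hR₀ hw1 hko2 hμ hk₀; omega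
  have nTcH : σ.Tc P + P.w + 2 * σ.kc P ≤ 0 := by clear * - ha3 hR₀ hw1 hkc2 hμ hk₀; omega
  have he2r : 2 * P.e ≤ P.rB := by clear * - he1 hrB1 hμ hk₀; omega
  have he2r' : 2 * P.e ≤ P.rW := by clear * - he1 hrW1 hμ hk₀; omega
  constructor
  · rw [Finset.disjoint_left]
    intro v hv hv'
    rw [mem_triBall_iff] at hv
    rcases mem_Pfin_cases hv' with hP | hP | hP | hP
    · have := (norm_of_mem_enearSet hσ.hio nw nLo nwwo nfo nToL nToH hP).1; clear * - hv this; omega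
    · obtain ⟨T, hT, hvT⟩ := hP
      have := (triNorm_mem_of_mem_thinRing he2r (mem_of_mem_arc hT) hvT).1
      clear * - hv this hrB1 hμ hs he1 hk₀; omega
    · have := le_norm_of_mem_triStrip hP; clear * - hv this hrB1 he1 hμ hk₀; omega
    · have : v 0 ≤ triNorm v := le_triNorm_iff_lin.2 (Or.inl le_rfl)
      clear * - hv this hP hN hN8 hM hμ hk₀; omega
  · rw [Finset.disjoint_left]
    intro v hv hv'
    rw [mem_triBall_iff] at hv
    rcases mem_Mfin_cases hv' with hQ | hQ | hQ | hQ
    · have := (norm_of_mem_enearSet hσ.hic nw nLc nwwc nfc nTcL nTcH hQ).1; clear * - hv this; omega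
    · obtain ⟨T, hT, hvT⟩ := hQ
      have := (triNorm_mem_of_mem_thinRing he2r' (mem_of_mem_arc hT) hvT).1
      rw [triNorm_neg] at this
      clear * - hv this hrW1 hμ hs he1 hk₀; omega
    · have := le_norm_of_mem_triStrip hQ; rw [triNorm_neg] at this; clear * - hv this hrW1 he1 hμ hk₀; omega
    · have : (-v) 0 ≤ triNorm v := by rw [← triNorm_neg]; exact le_triNorm_iff_lin.2 (Or.inl le_rfl)
      clear * - hv this hQ hN hN8 hM hμ hk₀; omega

end ESlot

end Literature.Probability.Percolation
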